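import Literature.Topology.FourManifolds.Rasmussen
import Literature.Topology.FourManifolds.RasmussenProofs
import Literature.Topology.FourManifolds.LeeRasmussenProofs
import Literature.Topology.FourManifolds.SliceGenusSeifertProofs
import Literature.Topology.FourManifolds.SliceGenusConcordanceProofs
import Literature.Topology.FourManifolds.SliceRibbonConcordanceProofs
import Literature.Topology.FourManifolds.SliceGenusMirrorProofs
import Literature.Topology.FourManifolds.KnotsProofs
import HarnessLib

/-!
# Rasmussen's slice-genus bound `|s(K)| ≤ 2 g₄(K)`: the assembly (sibling of `Rasmussen.lean`)

Sibling proof file of the statement file `Rasmussen.lean` for its named fact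
`Literature.Topology.FourManifolds.abs_le_two_mul_sliceGenus` — Rasmussen's **Theorem 1**,
*"`|s(K)| ≤ 2 g_*(K)`, where `g_*(K)` denotes the slice genus"* (J. Rasmussen, *Khovanov homology
and the slice genus*, Invent. Math. 182 (2010) 419–447 = arXiv:math/0402131, Thm. 1, p. 3 of the
arXiv text; proof in §4.4, p. 10). Everything here is **proved**; no definition and no named fact
is introduced (D-0026). It is the companion of the two sibling assemblies already in the tree,
`RasmussenSliceProofs.lean` (`eq_zero_of_isSmoothlySlice`, the case `g = 0`) and the "direct
route" section of `RasmussenConcordanceProofs.lean` (`HasRasmussenInvariant.eq_of_isConcordant`),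
and it is stated in the same vocabulary so that one upstream theorem on cobordism maps feeds all
three.

## The printed proof (arXiv:math/0402131, p. 10)

> *Suppose `K ⊂ S³` bounds an oriented surface of genus `g` in `B⁴`. Then there is an orientable
> connected cobordism of Euler characteristic `-2g` between `K` and the unknot `U` in
> `ℝ³ × [0,1]`. Let `x ∈ Kh'(K) - {0}` be a class for which `s(x)` is maximal. Then `φ_S(x)` is a
> nonzero element of `Kh'(U)` (Cor. 4.2). Now `φ_S` is a filtered map with filtered degree `-2g`,
> so `s(φ_S(x)) ≥ s(x) - 2g`. On the other hand, `s_max(U) = 1`, so `s(φ_S(x)) ≤ 1`. It follows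
> that `s(x) ≤ 2g + 1`, so `s_max(K) ≤ 2g + 1` and `s(K) ≤ 2g`. To show that `s(K) ≥ -2g`, we
> apply the same argument to `K̄` (which bounds a surface `S̄` of genus `g`) and use the fact that
> `s(K̄) = -s(K)`.*

The ingredients are: Lee's basis and `s_max(U) = 1` (§2.4, §3; in the tree `leeSMax_empty`),
the filtration calculus of §2.2 (a filtered map of degree `k` does not lower `s` by more than
`-k`), the cobordism maps `φ_S` of §4.2 with their filtered degree `χ(S)` and Cor. 4.2
(`φ_S` is an isomorphism for a connected cobordism between knots), the decomposition of a smooth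
cobordism into elementary ones (§4.1, movie moves), and for the lower bound the mirror formula
`s(K̄) = -s(K)` (§3) with `g₄(K̄) = g₄(K)`.

## What is proved here

This file isolates, sorry-free, everything in that argument which does **not** depend on the
(absent) maps `φ_S` on Lee homology induced by link cobordisms:

* `GaussDiagram.leeSMax_le_add_of_filtered`, `GaussDiagram.leeSMax_le_add_of_filteredClasses` —
  the filtration calculus with a degree shift: a map of degree-zero Lee cycles (resp. classes)
  `G → G'` which kills no nonzero homology class and lowers the filtration degree by at most `k`
  (*"filtered of degree `-k`"*) gives `s_max(G) ≤ s_max(G') + k` (Rasmussen §2.2, Def. 3.1; the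
  case `k = 0` is `GaussDiagram.leeSMax_le_of_filtered` of `LeeRasmussenProofs.lean`);
* `GaussDiagram.rasmussenInvariant_le_of_leeSMax_le`,
  `GaussDiagram.abs_rasmussenInvariant_le_of_leeSMax` — the arithmetic end of the proof:
  `s_max(G) ≤ 1 + k` gives `s(G) ≤ k`, and together with `1 ≤ s_max(G) + k` it gives `|s(G)| ≤ k`
  (`s = s_max - 1`, Def. 3.4; the junk values of the total `rasmussenInvariant` are harmless);
* `GaussDiagram.rasmussenInvariant_le_of_filtered_empty`,
  `GaussDiagram.abs_rasmussenInvariant_le_of_filtered_empty` (and the `Classes` forms) — hence a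
  filtered degree `-k`, class-injective map to the crossingless unknot diagram
  (`GaussDiagram.empty`, `s_max(U) = 1`, `leeSMax_empty`) gives `s(G) ≤ k`, and such maps in both
  directions give `|s(G)| ≤ k`;
* `abs_rasmussenInvariant_le_of_hasSliceSurfaceOfGenus`, `abs_le_two_mul_sliceGenus_of_diagram`,
  `abs_le_two_mul_sliceGenus_iff_diagram` — the named fact is **equivalent** to its diagrammatic
  core *"every regular projection of a knot bounding a slice surface of genus `g` reads a Gauss
  diagram with `|s| ≤ 2g`"* (`HasRasmussenInvariant` quantifies over isotopic representatives in
  regular position; the slice genus is an isotopy invariant, `Knot.IsConcordant.sliceGenus_eq_holds`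
  with `Knot.IsConcordant.of_isIsotopic_holds`, and is attained,
  `Knot.hasSliceSurfaceOfGenus_sliceGenus'`);
* `abs_le_two_mul_sliceGenus_of_filtered`, `abs_le_two_mul_sliceGenus_of_filteredClasses` —
  **the assembly**: the named fact follows as soon as every knot `K` in regular position `P`
  bounding a slice surface of genus `g` comes with class-injective maps of degree-zero Lee cycles
  (resp. classes) `P.diagram ⇄ GaussDiagram.empty` filtered of degree `-2g`. In Rasmussen's proof
  these are `φ_S` for the connected genus-`g` cobordism `S : K → U` cut out of the slice surface
  and `φ` of the reversed cobordism `U → K` (also connected, `χ = -2g`), presented as movies of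
  Reidemeister and Morse moves ending at the crossingless diagram of the round unknot (§4.1–4.2,
  Cor. 4.2);
* `le_two_mul_sliceGenus_of_filtered`, `abs_le_two_mul_sliceGenus_of_le_of_mirror`,
  `abs_le_two_mul_sliceGenus_of_filtered_of_mirror` — **Rasmussen's argument verbatim**: maps in
  the direction `K → U` alone give the upper bound `s(K) ≤ 2 g₄(K)` for all knots, and the upper
  bound for all knots together with the mirror formula (the named fact
  `HasRasmussenInvariant.mirror`, §3; its diagrammatic half `GaussDiagram.rasmussenInvariant_mirror`
  is the theorem `rasmussenInvariant_mirror_holds` of `LeeRasmussenMirrorDischarge.lean`) and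
  `g₄(K̄) = g₄(K)` (`Knot.sliceGenus_mirror_holds`) gives the fact;
* `eq_zero_of_isSmoothlySlice_of_filtered_sliceSurface` — under the hypothesis of the assembly the
  named fact `eq_zero_of_isSmoothlySlice` follows too
  (`eq_zero_of_isSmoothlySlice_of_abs_le_two_mul_sliceGenus`, `RasmussenProofs.lean`).

So the discharge `abs_le_two_mul_sliceGenus_holds` (and with it the Milnor conjecture
`sliceGenus_torusKnot`, reduced to this fact in `TorusKnotSeifertSurface.lean`) is exactly one
theorem away: the cobordism maps `φ_S` of §4 for a genus-`g` cobordism between a knot diagram and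
the crossingless unknot diagram. Those maps live on Lee complexes of *link* diagrams (a saddle
changes the number of components), which the tree does not have yet (`GaussDiagram` is
knots-only), and their existence for a smooth slice surface needs the movie decomposition of
§4.1 (Carter–Saito); the hypotheses below are the exact interface they have to meet.

## References

* J. Rasmussen, *Khovanov homology and the slice genus*, Invent. Math. 182 (2010) 419–447
  (arXiv:math/0402131): Thm. 1 (p. 3), §2.2 (filtered maps and the induced filtration `s` on
  homology), Def. 3.1 (`s_min`, `s_max`), Def. 3.4 (`s(K) = s_max - 1`), §3 (`s(K̄) = -s(K)`),
  §4.1 (elementary cobordisms), §4.2 (*"`φ_S` … is a filtered map of degree `χ(S)`"*), Prop. 4.1,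
  Cor. 4.2 (*"If `S` is a connected cobordism between knots `K₀` and `K₁`, then `φ_S` is an
  isomorphism"*), §4.4 (proof of Thm. 1, p. 10). [cite: Rasmussen2010, Thm. 1]
* E. S. Lee, *An endomorphism of the Khovanov invariant*, Adv. Math. 197 (2005), Thm. 4.2.
* C. Livingston, *A survey of classical knot concordance*, Handbook of Knot Theory (2005), §9.5
  (`g₄` is an invariant of the concordance class, in particular of the knot type; `g₄(K̄) = g₄(K)`).
  [cite: Livingston2005, §9.5]

## Design notes

No definitions, no named facts, no instances, no notation. The hypotheses of the conditional
theorems are stated with the tree's own objects (`GaussDiagram.leeCycles`,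
`GaussDiagram.LeeHomologyZero`, `GaussDiagram.qMin`, `GaussDiagram.classDegree`,
`Knot.RegularProjection`, `Knot.HasSliceSurfaceOfGenus`) in the shape consumed by
`GaussDiagram.leeSMax_le_of_filtered`; the degree shift `k` is a natural number added on the
right in `WithBot (WithTop ℤ)` (`qMin z ≤ qMin (φ z) + k`, i.e. `s(φ z) ≥ s(z) - k`). The
instance binder `[SphereEmbedding.SmoothnessFacts]` of `Knot.mirror` is discharged by the tree's
instance `SphereEmbedding.smoothnessFacts` (`KnotsProofs.lean`).
-/

open Function Set

noncomputable section

namespace Literature.Topology.FourManifolds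

namespace GaussDiagram

variable {G G' : GaussDiagram}

/-! ## The filtration calculus with a degree shift (Rasmussen (2010), §2.2) -/

/-- **A filtered map of degree `-k` raises `s_max` by at most `k`** (cycle level). If `φ` sends
degree-zero Lee cycles of `G` to degree-zero Lee cycles of `G'`, kills no nonzero homology class
and lowers the filtration degree `qMin` by at most `k` (`qMin z ≤ qMin (φ z) + k`, i.e. `φ` is
filtered of degree `-k`), then `s_max(G) ≤ s_max(G') + k`: the class of `φ z` is a nonzero class
of filtration degree at least `qMin z - k`. This is the step *"`φ_S` is a filtered map with
filtered degree `-2g`, so `s(φ_S(x)) ≥ s(x) - 2g` … so `s_max(K) ≤ 2g + 1`"* of the proof of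
Thm. 1. Rasmussen (2010), §2.2 (filtered maps of degree `k`), Def. 3.1, §4.4 (p. 10).
[cite: Rasmussen2010, §2.2] -/
theorem leeSMax_le_add_of_filtered (k : ℕ) (φ : G.leeCycles → G'.leeCycles)
    (hinj : ∀ z : G.leeCycles, (Submodule.Quotient.mk (φ z) : G'.LeeHomologyZero) = 0 →
      (Submodule.Quotient.mk z : G.LeeHomologyZero) = 0)
    (hfilt : ∀ z : G.leeCycles, qMin z.1 ≤ qMin (φ z).1 + k) :
    G.leeSMax ≤ G'.leeSMax + k := by
  refine iSup₂_le fun α hα ↦ iSup₂_le fun z hz ↦ ?_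
  have hz : Submodule.Quotient.mk z = α := hz
  have hne : (Submodule.Quotient.mk (φ z) : G'.LeeHomologyZero) ≠ 0 := fun h0 ↦
    hα (hz ▸ hinj z h0)
  have hle : qMin (φ z).1 ≤ G'.leeSMax :=
    le_iSup₂_of_le (Submodule.Quotient.mk (φ z)) hne (le_iSup₂_of_le (φ z) rfl le_rfl)
  exact (hfilt z).trans (add_le_add_left hle _)

/-- **A filtered map of degree `-k` raises `s_max` by at most `k`** (homology level). If
`Φ : Kh'⁰(G) → Kh'⁰(G')` is any map of degree-zero Lee homology classes which kills no nonzero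
class and lowers Rasmussen's filtration degree of nonzero classes by at most `k`
(`classDegree α ≤ classDegree (Φ α) + k`), then `s_max(G) ≤ s_max(G') + k`. This is the form
delivered by §4.2: *"`φ_S` … is a filtered map of degree `χ(S)`"* on `Kh'`, injective for a
connected cobordism between knots (Cor. 4.2). Rasmussen (2010), §2.2, Def. 3.1, §4.2, Cor. 4.2.
[cite: Rasmussen2010, §2.2] -/
theorem leeSMax_le_add_of_filteredClasses (k : ℕ) (Φ : G.LeeHomologyZero → G'.LeeHomologyZero)
    (hinj : ∀ α, Φ α = 0 → α = 0)
    (hfilt : ∀ α, α ≠ 0 → classDegree α ≤ classDegree (Φ α) + k) :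
    G.leeSMax ≤ G'.leeSMax + k := by
  refine iSup₂_le fun α hα ↦ (hfilt α hα).trans (add_le_add_left ?_ _)
  exact le_iSup₂_of_le (Φ α) (fun h ↦ hα (hinj α h)) le_rfl

/-! ## The arithmetic end of the proof: from `s_max` to `s = s_max - 1` (Def. 3.4) -/

/-- **`s_max(G) ≤ 1 + k` gives `s(G) ≤ k`.** The Rasmussen invariant is `s = s_max - 1`
(Def. 3.4; the total `rasmussenInvariant` reads the junk values `⊥ ↦ ⊤ ↦ 0` before subtracting,
and in both junk cases `s = -1 ≤ k`). This is the step *"`s_max(K) ≤ 2g + 1` and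
`s(K) ≤ 2g`"* of the proof of Thm. 1. Rasmussen (2010), Def. 3.4, §4.4 (p. 10).
[cite: Rasmussen2010, Def. 3.4] -/
theorem rasmussenInvariant_le_of_leeSMax_le (k : ℕ) (h : G.leeSMax ≤ 1 + k) :
    G.rasmussenInvariant ≤ k := by
  unfold rasmussenInvariant
  generalize G.leeSMax = x at h
  induction x using WithBot.recBotCoe with
  | bot =>
    simp only [WithBot.unbotD_bot, WithTop.untopD_top]
    omega
  | coe y =>
    induction y using WithTop.recTopCoe with
    | top =>
      simp only [WithBot.unbotD_coe, WithTop.untopD_top]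
      omega
    | coe m =>
      simp only [WithBot.unbotD_coe, WithTop.untopD_coe]
      norm_cast at h
      omega

/-- **`s_max(G) ≤ 1 + k` and `1 ≤ s_max(G) + k` give `|s(G)| ≤ k`** (`s = s_max - 1`,
Def. 3.4): the two inequalities force `s_max(G)` to be a genuine integer `m` with
`1 - k ≤ m ≤ 1 + k`. With `1 = s_max(U)` (`leeSMax_empty`) these are the two halves of the proof
of Thm. 1 (*"`s_max(K) ≤ 2g + 1`"* and the same for the reversed direction).
Rasmussen (2010), Def. 3.4, §4.4 (p. 10). [cite: Rasmussen2010, Def. 3.4] -/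
theorem abs_rasmussenInvariant_le_of_leeSMax (k : ℕ) (h₁ : G.leeSMax ≤ 1 + k)
    (h₂ : 1 ≤ G.leeSMax + k) : |G.rasmussenInvariant| ≤ k := by
  refine abs_le.2 ⟨?_, rasmussenInvariant_le_of_leeSMax_le k h₁⟩
  unfold rasmussenInvariant
  generalize G.leeSMax = x at h₁ h₂
  induction x using WithBot.recBotCoe with
  | bot =>
    exfalso
    rw [WithBot.bot_add] at h₂
    exact WithBot.one_ne_bot (le_bot_iff.1 h₂)
  | coe y =>
    induction y using WithTop.recTopCoe with
    | top =>
      exfalso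
      norm_cast at h₁
    | coe m =>
      simp only [WithBot.unbotD_coe, WithTop.untopD_coe]
      norm_cast at h₂
      omega

/-! ## Filtered maps to and from the unknot (Rasmussen (2010), §4.4: `s_max(U) = 1`) -/

/-- **A filtered degree `-k`, class-injective map to the unknot gives `s ≤ k`** (cycle level).
If a Gauss diagram `G` admits a map of degree-zero Lee cycles to the crossingless diagram of the
round unknot which kills no nonzero homology class and lowers `qMin` by at most `k`, then
`s(G) ≤ k`: `s_max(G) ≤ s_max(U) + k = 1 + k` (`leeSMax_le_add_of_filtered`, `leeSMax_empty`).
With `k = 2g` and `φ = φ_S` of a genus-`g` cobordism `K → U` this is the first half of the proof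
of Thm. 1. Rasmussen (2010), §4.4 (p. 10). [cite: Rasmussen2010, Thm. 1] -/
theorem rasmussenInvariant_le_of_filtered_empty (k : ℕ)
    (φ : G.leeCycles → GaussDiagram.empty.leeCycles)
    (hφ : ∀ z : G.leeCycles,
      (Submodule.Quotient.mk (φ z) : GaussDiagram.empty.LeeHomologyZero) = 0 →
      (Submodule.Quotient.mk z : G.LeeHomologyZero) = 0)
    (hφq : ∀ z : G.leeCycles, qMin z.1 ≤ qMin (φ z).1 + k) :
    G.rasmussenInvariant ≤ k :=
  rasmussenInvariant_le_of_leeSMax_le k (leeSMax_empty ▸ leeSMax_le_add_of_filtered k φ hφ hφq)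

/-- **Filtered degree `-k`, class-injective maps to and from the unknot give `|s| ≤ k`** (cycle
level): `s_max(G) ≤ 1 + k` along `φ : G → U` and `1 = s_max(U) ≤ s_max(G) + k` along
`ψ : U → G` (`leeSMax_le_add_of_filtered`, `leeSMax_empty`), then
`abs_rasmussenInvariant_le_of_leeSMax`. With `k = 2g`, `φ = φ_S` for a connected genus-`g`
cobordism `S : K → U` and `ψ = φ` of the reversed cobordism `U → K` this is the proof of Thm. 1
(the printed text obtains the lower bound from the mirror image instead; see
`abs_le_two_mul_sliceGenus_of_le_of_mirror`). Rasmussen (2010), §4.4 (p. 10).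
[cite: Rasmussen2010, Thm. 1] -/
theorem abs_rasmussenInvariant_le_of_filtered_empty (k : ℕ)
    (φ : G.leeCycles → GaussDiagram.empty.leeCycles)
    (ψ : GaussDiagram.empty.leeCycles → G.leeCycles)
    (hφ : ∀ z : G.leeCycles,
      (Submodule.Quotient.mk (φ z) : GaussDiagram.empty.LeeHomologyZero) = 0 →
      (Submodule.Quotient.mk z : G.LeeHomologyZero) = 0)
    (hφq : ∀ z : G.leeCycles, qMin z.1 ≤ qMin (φ z).1 + k)
    (hψ : ∀ z : GaussDiagram.empty.leeCycles,
      (Submodule.Quotient.mk (ψ z) : G.LeeHomologyZero) = 0 →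
      (Submodule.Quotient.mk z : GaussDiagram.empty.LeeHomologyZero) = 0)
    (hψq : ∀ z : GaussDiagram.empty.leeCycles, qMin z.1 ≤ qMin (ψ z).1 + k) :
    |G.rasmussenInvariant| ≤ k :=
  abs_rasmussenInvariant_le_of_leeSMax k (leeSMax_empty ▸ leeSMax_le_add_of_filtered k φ hφ hφq)
    (leeSMax_empty ▸ leeSMax_le_add_of_filtered k ψ hψ hψq)

/-- **A filtered degree `-k`, class-injective map on Lee homology to the unknot gives `s ≤ k`**
(homology level; `leeSMax_le_add_of_filteredClasses`, `leeSMax_empty`,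
`rasmussenInvariant_le_of_leeSMax_le`). Rasmussen (2010), §4.2, Cor. 4.2, §4.4 (p. 10).
[cite: Rasmussen2010, Thm. 1] -/
theorem rasmussenInvariant_le_of_filteredClasses_empty (k : ℕ)
    (Φ : G.LeeHomologyZero → GaussDiagram.empty.LeeHomologyZero)
    (hΦ : ∀ α, Φ α = 0 → α = 0) (hΦq : ∀ α, α ≠ 0 → classDegree α ≤ classDegree (Φ α) + k) :
    G.rasmussenInvariant ≤ k :=
  rasmussenInvariant_le_of_leeSMax_le k
    (leeSMax_empty ▸ leeSMax_le_add_of_filteredClasses k Φ hΦ hΦq)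

/-- **Filtered degree `-k`, class-injective maps on Lee homology to and from the unknot give
`|s| ≤ k`** (homology level; `leeSMax_le_add_of_filteredClasses` twice, `leeSMax_empty`,
`abs_rasmussenInvariant_le_of_leeSMax`). Rasmussen (2010), §4.2, Cor. 4.2, §4.4 (p. 10).
[cite: Rasmussen2010, Thm. 1] -/
theorem abs_rasmussenInvariant_le_of_filteredClasses_empty (k : ℕ)
    (Φ : G.LeeHomologyZero → GaussDiagram.empty.LeeHomologyZero)
    (Ψ : GaussDiagram.empty.LeeHomologyZero → G.LeeHomologyZero)
    (hΦ : ∀ α, Φ α = 0 → α = 0) (hΦq : ∀ α, α ≠ 0 → classDegree α ≤ classDegree (Φ α) + k)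
    (hΨ : ∀ β, Ψ β = 0 → β = 0) (hΨq : ∀ β, β ≠ 0 → classDegree β ≤ classDegree (Ψ β) + k) :
    |G.rasmussenInvariant| ≤ k :=
  abs_rasmussenInvariant_le_of_leeSMax k
    (leeSMax_empty ▸ leeSMax_le_add_of_filteredClasses k Φ hΦ hΦq)
    (leeSMax_empty ▸ leeSMax_le_add_of_filteredClasses k Ψ hΨ hΨq)

end GaussDiagram

/-! ## The knot-level fact and its diagrammatic core -/

section SPC4

/-- **The named fact read on diagrams.** Rasmussen's bound `abs_le_two_mul_sliceGenus`
(hypothesis `h`) says in particular that a regular projection `P` of a knot `K` bounding a slice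
surface of genus `g` reads a Gauss diagram with `|s| ≤ 2g`: `K` is isotopic to itself
(`SphereEmbedding.IsIsotopic.refl`), so `|s(P.diagram)| ≤ 2 g₄(K)`, and `g₄(K) ≤ g`
(`Knot.sliceGenus_le_of_hasSliceSurfaceOfGenus`). Rasmussen (2010), Thm. 1 (`s(K)` is read on any
diagram of `K`, Def. 3.4). [cite: Rasmussen2010, Thm. 1] -/
theorem abs_rasmussenInvariant_le_of_hasSliceSurfaceOfGenus (h : abs_le_two_mul_sliceGenus)
    {K : Knot} (P : K.RegularProjection) {g : ℕ} (hg : K.HasSliceSurfaceOfGenus g) :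
    |P.diagram.rasmussenInvariant| ≤ 2 * (g : ℤ) := by
  have hs : |P.diagram.rasmussenInvariant| ≤ 2 * (K.sliceGenus : ℤ) :=
    h ⟨K, P.diagram, SphereEmbedding.IsIsotopic.refl _, ⟨P, rfl⟩, rfl⟩
  have hle : (K.sliceGenus : ℤ) ≤ g := by
    exact_mod_cast Knot.sliceGenus_le_of_hasSliceSurfaceOfGenus hg
  linarith

/-- **Reduction of `abs_le_two_mul_sliceGenus` to knots in regular position.** If every regular
projection `P` of every knot `K` bounding a slice surface of genus `g` reads a Gauss diagram with
`|s(P.diagram)| ≤ 2g`, then the named fact holds: a witness of `K.HasRasmussenInvariant s` is a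
regular projection `P` of a knot `K'` isotopic to `K`, the slice genus is an invariant of the knot
type (`Knot.IsConcordant.sliceGenus_eq_holds` with `Knot.IsConcordant.of_isIsotopic_holds`:
isotopic knots are concordant and `g₄` is a concordance invariant, Livingston (2005), §9.5) and
`K'` bounds a slice surface of genus `g₄(K')` (`Knot.hasSliceSurfaceOfGenus_sliceGenus'`, from
Seifert's theorem). Rasmussen (2010), Thm. 1. [cite: Rasmussen2010, Thm. 1] -/
theorem abs_le_two_mul_sliceGenus_of_diagram
    (h : ∀ {K : Knot} (P : K.RegularProjection) {g : ℕ}, K.HasSliceSurfaceOfGenus g →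
      |P.diagram.rasmussenInvariant| ≤ 2 * (g : ℤ)) :
    abs_le_two_mul_sliceGenus := by
  rintro K s ⟨K', D, hKK', ⟨P, rfl⟩, rfl⟩
  rw [Knot.IsIsotopic.sliceGenus_eq Knot.IsConcordant.of_isIsotopic_holds
    Knot.IsConcordant.sliceGenus_eq_holds hKK']
  exact h P (Knot.hasSliceSurfaceOfGenus_sliceGenus' K')

/-- **`abs_le_two_mul_sliceGenus` is equivalent to its diagrammatic core**: the named fact holds
if and only if every regular projection of every knot bounding a slice surface of genus `g` reads
a Gauss diagram with `|s| ≤ 2g` (`abs_le_two_mul_sliceGenus_of_diagram` and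
`abs_rasmussenInvariant_le_of_hasSliceSurfaceOfGenus`). Rasmussen (2010), Thm. 1.
[cite: Rasmussen2010, Thm. 1] -/
theorem abs_le_two_mul_sliceGenus_iff_diagram :
    abs_le_two_mul_sliceGenus ↔
      ∀ {K : Knot} (P : K.RegularProjection) {g : ℕ}, K.HasSliceSurfaceOfGenus g →
        |P.diagram.rasmussenInvariant| ≤ 2 * (g : ℤ) :=
  ⟨fun h _ P _ hg ↦ abs_rasmussenInvariant_le_of_hasSliceSurfaceOfGenus h P hg,
    fun h ↦ abs_le_two_mul_sliceGenus_of_diagram h⟩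

/-- **Reduction of the upper bound `s(K) ≤ 2 g₄(K)` to knots in regular position**: if every
regular projection `P` of every knot bounding a slice surface of genus `g` reads a Gauss diagram
with `s(P.diagram) ≤ 2g`, then `s ≤ 2 g₄(K)` whenever `K.HasRasmussenInvariant s` (same transport
as `abs_le_two_mul_sliceGenus_of_diagram`). This is the first half of Thm. 1, *"so
`s(K) ≤ 2g`"*. Rasmussen (2010), Thm. 1, §4.4 (p. 10). [cite: Rasmussen2010, Thm. 1] -/
theorem le_two_mul_sliceGenus_of_diagram
    (h : ∀ {K : Knot} (P : K.RegularProjection) {g : ℕ}, K.HasSliceSurfaceOfGenus g →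
      P.diagram.rasmussenInvariant ≤ 2 * (g : ℤ))
    {K : Knot} {s : ℤ} (hK : K.HasRasmussenInvariant s) : s ≤ 2 * (K.sliceGenus : ℤ) := by
  obtain ⟨K', D, hKK', ⟨P, rfl⟩, rfl⟩ := hK
  rw [Knot.IsIsotopic.sliceGenus_eq Knot.IsConcordant.of_isIsotopic_holds
    Knot.IsConcordant.sliceGenus_eq_holds hKK']
  exact h P (Knot.hasSliceSurfaceOfGenus_sliceGenus' K')

/-! ## The assembly: Thm. 1 from the cobordism maps `φ_S` (Rasmussen (2010), §4) -/

/-- **The assembly of Rasmussen's proof of Theorem 1, cycle level.** Suppose that for every knot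
`K` in regular position `P` and every slice surface of genus `g` for `K` there are maps of
degree-zero Lee cycles `φ : Z⁰(P.diagram) → Z⁰(U)` and `ψ : Z⁰(U) → Z⁰(P.diagram)`,
`U = GaussDiagram.empty` the crossingless diagram of the round unknot, each killing no nonzero
Lee homology class and lowering the filtration degree `qMin` by at most `2g` — in Rasmussen's
proof, the maps `φ_S` and `φ_{S'}` induced on Lee homology by the connected genus-`g` cobordism
`S` from `K` to the unknot cut out of the slice surface (*"an orientable connected cobordism of
Euler characteristic `-2g` between `K` and the unknot"*) and by the reversed cobordism
`S' : U → K`, presented as movies of Reidemeister and Morse moves (§4.1): each is *"a filtered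
map of degree `χ(S)`"* `= -2g` (§4.2) and *"an isomorphism"* since `S` is a connected cobordism
between knots (Cor. 4.2, from Prop. 4.1 and Lee's basis, §2.4). Then `|s(K)| ≤ 2 g₄(K)` for
every knot, i.e. the named fact `abs_le_two_mul_sliceGenus` holds
(`GaussDiagram.abs_rasmussenInvariant_le_of_filtered_empty` and
`abs_le_two_mul_sliceGenus_of_diagram`). Rasmussen (2010), Thm. 1 and its proof, §4.4 (p. 10 of
arXiv:math/0402131). [cite: Rasmussen2010, Thm. 1] -/
theorem abs_le_two_mul_sliceGenus_of_filtered
    (h : ∀ {K : Knot} (P : K.RegularProjection) {g : ℕ}, K.HasSliceSurfaceOfGenus g →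
      ∃ (φ : P.diagram.leeCycles → GaussDiagram.empty.leeCycles)
        (ψ : GaussDiagram.empty.leeCycles → P.diagram.leeCycles),
        (∀ z : P.diagram.leeCycles,
          (Submodule.Quotient.mk (φ z) : GaussDiagram.empty.LeeHomologyZero) = 0 →
          (Submodule.Quotient.mk z : P.diagram.LeeHomologyZero) = 0) ∧
        (∀ z : P.diagram.leeCycles,
          GaussDiagram.qMin z.1 ≤ GaussDiagram.qMin (φ z).1 + (2 * g : ℕ)) ∧
        (∀ z : GaussDiagram.empty.leeCycles,
          (Submodule.Quotient.mk (ψ z) : P.diagram.LeeHomologyZero) = 0 →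
          (Submodule.Quotient.mk z : GaussDiagram.empty.LeeHomologyZero) = 0) ∧
        (∀ z : GaussDiagram.empty.leeCycles,
          GaussDiagram.qMin z.1 ≤ GaussDiagram.qMin (ψ z).1 + (2 * g : ℕ))) :
    abs_le_two_mul_sliceGenus := by
  refine abs_le_two_mul_sliceGenus_of_diagram fun P g hg ↦ ?_
  obtain ⟨φ, ψ, hφ, hφq, hψ, hψq⟩ := h P hg
  have := GaussDiagram.abs_rasmussenInvariant_le_of_filtered_empty (2 * g) φ ψ hφ hφq hψ hψq
  exact_mod_cast this

/-- **The assembly of Rasmussen's proof of Theorem 1, homology level.** Suppose that for every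
knot `K` in regular position `P` and every slice surface of genus `g` for `K` there are maps of
degree-zero Lee homology classes `Φ : Kh'⁰(P.diagram) → Kh'⁰(U)` and `Ψ : Kh'⁰(U) → Kh'⁰(P.diagram)`
(`U = GaussDiagram.empty`), each killing no nonzero class and lowering Rasmussen's filtration
degree `classDegree` of nonzero classes by at most `2g` — Rasmussen's `φ_S`, `φ_{S'}` for the
connected genus-`g` cobordism `S : K → U` cut out of the slice surface and its reverse: filtered
of degree `χ(S) = -2g` (§4.2) and isomorphisms (Cor. 4.2). Then the named fact
`abs_le_two_mul_sliceGenus` holds (`GaussDiagram.abs_rasmussenInvariant_le_of_filteredClasses_empty`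
and `abs_le_two_mul_sliceGenus_of_diagram`). Rasmussen (2010), Thm. 1, §4.2, Cor. 4.2, §4.4
(p. 10). [cite: Rasmussen2010, Thm. 1] -/
theorem abs_le_two_mul_sliceGenus_of_filteredClasses
    (h : ∀ {K : Knot} (P : K.RegularProjection) {g : ℕ}, K.HasSliceSurfaceOfGenus g →
      ∃ (Φ : P.diagram.LeeHomologyZero → GaussDiagram.empty.LeeHomologyZero)
        (Ψ : GaussDiagram.empty.LeeHomologyZero → P.diagram.LeeHomologyZero),
        (∀ α, Φ α = 0 → α = 0) ∧
        (∀ α, α ≠ 0 →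
          GaussDiagram.classDegree α ≤ GaussDiagram.classDegree (Φ α) + (2 * g : ℕ)) ∧
        (∀ β, Ψ β = 0 → β = 0) ∧
        (∀ β, β ≠ 0 →
          GaussDiagram.classDegree β ≤ GaussDiagram.classDegree (Ψ β) + (2 * g : ℕ))) :
    abs_le_two_mul_sliceGenus := by
  refine abs_le_two_mul_sliceGenus_of_diagram fun P g hg ↦ ?_
  obtain ⟨Φ, Ψ, hΦ, hΦq, hΨ, hΨq⟩ := h P hg
  have := GaussDiagram.abs_rasmussenInvariant_le_of_filteredClasses_empty (2 * g) Φ Ψ hΦ hΦq hΨ hΨq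
  exact_mod_cast this

/-! ## Rasmussen's argument verbatim: the upper bound for all knots and the mirror image -/

/-- **The upper bound `s(K) ≤ 2 g₄(K)` from the cobordism maps `K → U` alone** (cycle level).
If every knot `K` in regular position `P` bounding a slice surface of genus `g` comes with a map
of degree-zero Lee cycles `φ : Z⁰(P.diagram) → Z⁰(U)` killing no nonzero homology class and
lowering `qMin` by at most `2g` (Rasmussen's `φ_S` for the genus-`g` cobordism `S : K → U`,
§4.2 and Cor. 4.2), then `s ≤ 2 g₄(K)` whenever `K.HasRasmussenInvariant s`
(`GaussDiagram.rasmussenInvariant_le_of_filtered_empty` and `le_two_mul_sliceGenus_of_diagram`).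
This is the first half of the printed proof, *"so `s_max(K) ≤ 2g + 1` and `s(K) ≤ 2g`"*.
Rasmussen (2010), Thm. 1, §4.4 (p. 10). [cite: Rasmussen2010, Thm. 1] -/
theorem le_two_mul_sliceGenus_of_filtered
    (h : ∀ {K : Knot} (P : K.RegularProjection) {g : ℕ}, K.HasSliceSurfaceOfGenus g →
      ∃ φ : P.diagram.leeCycles → GaussDiagram.empty.leeCycles,
        (∀ z : P.diagram.leeCycles,
          (Submodule.Quotient.mk (φ z) : GaussDiagram.empty.LeeHomologyZero) = 0 →
          (Submodule.Quotient.mk z : P.diagram.LeeHomologyZero) = 0) ∧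
        (∀ z : P.diagram.leeCycles,
          GaussDiagram.qMin z.1 ≤ GaussDiagram.qMin (φ z).1 + (2 * g : ℕ)))
    {K : Knot} {s : ℤ} (hK : K.HasRasmussenInvariant s) : s ≤ 2 * (K.sliceGenus : ℤ) := by
  refine le_two_mul_sliceGenus_of_diagram (fun P g hg ↦ ?_) hK
  obtain ⟨φ, hφ, hφq⟩ := h P hg
  have := GaussDiagram.rasmussenInvariant_le_of_filtered_empty (2 * g) φ hφ hφq
  exact_mod_cast this

/-- **Thm. 1 from the upper bound for all knots and the mirror image** (the printed argument for
the lower bound: *"To show that `s(K) ≥ -2g`, we apply the same argument to `K̄` (which bounds a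
surface `S̄` of genus `g`) and use the fact that `s(K̄) = -s(K)`"*). If `s ≤ 2 g₄(K)` whenever
`K.HasRasmussenInvariant s` (hypothesis `hup`), and `s(K̄) = -s(K)` (the named fact
`HasRasmussenInvariant.mirror`, hypothesis `hmirror`; Rasmussen (2010), §3), then
`|s(K)| ≤ 2 g₄(K)`: the mirror has Rasmussen invariant `-s` and the same slice genus
(`Knot.sliceGenus_mirror_holds`: reflect the slice surface, Livingston (2005), §9.5), so
`-s ≤ 2 g₄(K̄) = 2 g₄(K)`. Rasmussen (2010), Thm. 1, §4.4 (p. 10). [cite: Rasmussen2010, Thm. 1] -/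
theorem abs_le_two_mul_sliceGenus_of_le_of_mirror (hmirror : HasRasmussenInvariant.mirror)
    (hup : ∀ {K : Knot} {s : ℤ}, K.HasRasmussenInvariant s → s ≤ 2 * (K.sliceGenus : ℤ)) :
    abs_le_two_mul_sliceGenus := by
  intro K s hK
  refine abs_le.2 ⟨?_, hup hK⟩
  have hm : -s ≤ 2 * (K.mirror.sliceGenus : ℤ) := hup (hmirror hK)
  rw [Knot.sliceGenus_mirror_holds K] at hm
  linarith

/-- **Thm. 1 from the cobordism maps `K → U` and the mirror image** (Rasmussen's proof
verbatim). If every knot `K` in regular position `P` bounding a slice surface of genus `g` comes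
with a map of degree-zero Lee cycles `φ : Z⁰(P.diagram) → Z⁰(U)` killing no nonzero homology
class and lowering `qMin` by at most `2g` (Rasmussen's `φ_S`, §4.2, Cor. 4.2), and
`s(K̄) = -s(K)` (the named fact `HasRasmussenInvariant.mirror`, §3), then the named fact
`abs_le_two_mul_sliceGenus` holds (`le_two_mul_sliceGenus_of_filtered` and
`abs_le_two_mul_sliceGenus_of_le_of_mirror`). Rasmussen (2010), Thm. 1, §4.4 (p. 10).
[cite: Rasmussen2010, Thm. 1] -/
theorem abs_le_two_mul_sliceGenus_of_filtered_of_mirror (hmirror : HasRasmussenInvariant.mirror)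
    (h : ∀ {K : Knot} (P : K.RegularProjection) {g : ℕ}, K.HasSliceSurfaceOfGenus g →
      ∃ φ : P.diagram.leeCycles → GaussDiagram.empty.leeCycles,
        (∀ z : P.diagram.leeCycles,
          (Submodule.Quotient.mk (φ z) : GaussDiagram.empty.LeeHomologyZero) = 0 →
          (Submodule.Quotient.mk z : P.diagram.LeeHomologyZero) = 0) ∧
        (∀ z : P.diagram.leeCycles,
          GaussDiagram.qMin z.1 ≤ GaussDiagram.qMin (φ z).1 + (2 * g : ℕ))) :
    abs_le_two_mul_sliceGenus :=
  abs_le_two_mul_sliceGenus_of_le_of_mirror hmirror (le_two_mul_sliceGenus_of_filtered h)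

/-! ## Consequence: slice knots have `s = 0` -/

/-- **Slice knots have `s = 0`, from the cobordism maps of slice surfaces.** Under the hypothesis
of `abs_le_two_mul_sliceGenus_of_filtered` the named fact `eq_zero_of_isSmoothlySlice` holds as
well: a smoothly slice knot has `g₄ = 0`, so `|s| ≤ 0`
(`eq_zero_of_isSmoothlySlice_of_abs_le_two_mul_sliceGenus`, `RasmussenProofs.lean`); compare the
sibling assembly `eq_zero_of_isSmoothlySlice_of_filtered` (`RasmussenSliceProofs.lean`), which
asks for the maps only for slice knots and with no degree shift. Rasmussen (2010), Thm. 1 (case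
`g = 0`), §4.4. [cite: Rasmussen2010, Thm. 1] -/
theorem eq_zero_of_isSmoothlySlice_of_filtered_sliceSurface
    (h : ∀ {K : Knot} (P : K.RegularProjection) {g : ℕ}, K.HasSliceSurfaceOfGenus g →
      ∃ (φ : P.diagram.leeCycles → GaussDiagram.empty.leeCycles)
        (ψ : GaussDiagram.empty.leeCycles → P.diagram.leeCycles),
        (∀ z : P.diagram.leeCycles,
          (Submodule.Quotient.mk (φ z) : GaussDiagram.empty.LeeHomologyZero) = 0 →
          (Submodule.Quotient.mk z : P.diagram.LeeHomologyZero) = 0) ∧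
        (∀ z : P.diagram.leeCycles,
          GaussDiagram.qMin z.1 ≤ GaussDiagram.qMin (φ z).1 + (2 * g : ℕ)) ∧
        (∀ z : GaussDiagram.empty.leeCycles,
          (Submodule.Quotient.mk (ψ z) : P.diagram.LeeHomologyZero) = 0 →
          (Submodule.Quotient.mk z : GaussDiagram.empty.LeeHomologyZero) = 0) ∧
        (∀ z : GaussDiagram.empty.leeCycles,
          GaussDiagram.qMin z.1 ≤ GaussDiagram.qMin (ψ z).1 + (2 * g : ℕ))) :
    eq_zero_of_isSmoothlySlice :=
  eq_zero_of_isSmoothlySlice_of_abs_le_two_mul_sliceGenus (abs_le_two_mul_sliceGenus_of_filtered h)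

end SPC4

end Literature.Topology.FourManifolds
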